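import Summits.QuantumFields.YangMills.Theorems.BalabanUVNodesN11KernelTransportInFibreChart
import Literature.MathematicalPhysics.QuantumFieldTheory.Balaban1983to89.T4TriangularFibredChart
import Literature.MathematicalPhysics.QuantumFieldTheory.Balaban1983to89.BlockAveragingHaarAC

/-!
# DAG node N11 — (B4)'s CHART HALF AT `fieldMeasure`, PRIVATE-COORDINATE EDITION: dag-n11-d's fibre-chart socket `hpush` ∕ `hfib` DISCHARGED for the averaging of
# record from per-bond inversions of its (0.4) one-variable fibre maps, and def-T's `transportOfRecord` AS THE RESAMPLED `dU`-INTEGRAL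

HEADER — WORK-UNIT METADATA.  Cell `pub-ymgap`, YM-PLAN Track A (HUMAN RULING D-0062 ∕ D-0149 ∕ D-0154 (3a)), WIDTH SEAT `pub-ymgap-dag-n11-w6` (g2) on node N11 [B14];
route `BalabanUVNodes`, key item K1⁷ `StabilityBAtRecordR13SepCoPH` = stmt-QuantumFields-20542 (helper lane, `--kind proof --supports 20542 --as helper`, count-neutral).
[I] = [Balaban1987RG1], [III] = [Balaban1988Convergent].  Bus: CLAIM-1 = INTENT-1 of this seat (R455 (A), pub-ymgap INBOX 2026-08-28T08:59Z).
Over dag-n11-d g14's `…N11KernelTransportInFibreChart` (p610288: the SOCKET — a fibre chart `(X, κ, Ψ, J)` of an averaging with `hpush` ∕ `hfib` ⟹ def-T's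
`kernelTransport` ∕ `transportOfRecord` IS a.e. the chart's fibre integral) and dag-n09-w6 g3's `T4TriangularFibredChart` (p616307: the fibred chart of a product measure from
PRIVATE COORDINATES — per-bond inversion data ⟹ `μ^ι⌊(A⁻¹U₀ ∩ S) = Φ_*((((ν^κ)⌊U₀) ⊗ μ^ι)·J)` and `A (Φ (V,U)) = V` wherever `J ≠ 0`).

WHY THIS FILE.  The dag-lead TABLE (v65–v67, row n11) carries «(B4): abstract half n11-d ✓ · the CHART HALF at `fieldMeasure` UNOWNED», and dag-n11-d g15 (I.32418 (t1)) names
the assembly at `avOfRecord` as the chart seats'.  Print's chart is «axial comb ∘ exponential chart ∘ (47)» ([III] p. 267); the tree has a SECOND road to the same socket that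
needs no Lie algebra, no background and no linearisation: Bałaban's block averaging (0.4) `avOfRecord F N K k = blockAvg expMeanLogSU` has PRIVATE COORDINATES — the central
crossing bond `β(c) = centralBond c` of each coarse bond `c` (`Ū(c′)` is blind to `U(β c)` for `c′ ≠ c`: `BlockAveragingHaarAC.isLocal_avgFun`; `β` injective:
`centralBond_injective`) — print's own distinguished bond «`(hB)(b₀(c)) = h(c)B(c)`» p. 267.  dag-n09-w6 g3's engine turns PER-BOND INVERSIONS of the one-variable maps
`g ↦ Ū′(c)`, `U′ = U[β(c) ↦ g]` — jointly measurable data `(Ω, T, ϑ, j)`: a fine window `Ω_c(U) ⊆ SU(N)` blind to the private coordinates of the environment `U`, a coarse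
window `T_c(U)`, a local inverse `ϑ_c(U,·)` on it (`hright`) with the INVERSE change-of-variables law against one-bond Haar measure (`hlaw`) — into a fibred chart whose
fibre coordinates are THE FINE CONFIGURATIONS THEMSELVES: `Ψ (V, U) = extend β (c ↦ ϑ_c(U, V c)) U` (resample the private coordinates by the inverses), Jacobian
`J (V, U) = 𝟙[∀ c, V c ∈ T_c(U)]·∏_c j_c(U, V c)`, charted set `S = {U | ∀ c, U(β c) ∈ Ω_c(U)}`.  Its consumer so far is N09's `hreg` (`Node00.RegSetOfFibredChart…`); dag-n09-w6's own
`F1-CONSUMER-MAP.md` §1 notes that the a.e. fibre form is exactly dag-n11-d's `hfib` and that the N11 reading «in a Summits sequel» was never written.  THIS FILE is that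
sequel: the socket's two hypotheses AT THE RECORD — `(dU, dV) = (fieldMeasure k, fieldMeasure (k+1))`, `avg = (avOfRecord F N K k).avg`, CONSTANT fibre reference
`κ := Kernel.const _ (fieldMeasure k)` (`Measure.compProd_const`) — from the per-bond data, and the socket's conclusions BY NAME: def-T's one-step transport of record of a
density supported in the charted windows IS, `dV`-a.e., the honest `dU`-integral `V ↦ ∫ dU J(V,U)·ρ(Ψ(V,U))` — print's `∫dU δ(ŪV⁻¹)ρ(U)` ([I] (0.4), [III] (3.1)) with the
δ-functions removed by SOLVING `Ū′(c) = V(c)` for the central bond variables, one coarse bond at a time.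

WHAT THIS FILE PROVES (0 `def`, 0 `sorry`, standard axioms).
§1 (generic, over p616307 §3's data): `compProd_const_withDensity_map_triChart_eq_restrict` (the socket's `hpush` ORIENTATION of p616307 ★★★, coarse reference `(ν^κ)⌊U₀`, kernel
`Kernel.const _ μ^ι`, charted set `A⁻¹U₀ ∩ S`) · `compProd_const_withDensity_map_triChart_eq_restrict_fineDomain` (`U₀ = univ`: coarse reference `ν^κ` on the nose, charted set `S`).
§2 (at the record, `k < K`): ★★ `hpush_privateChart_restrict` · ★★ `hpush_privateChart` · ★ `hfib_privateChart` (dag-n11-d's two displayed hypotheses LITERALLY) ·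
★★ `map_withDensity_avOfRecord_eq_withDensity_lintegral_privateChart` (socket §1 ★★ BY NAME: `(g·dU).map Ū = (V ↦ ∫⁻ dU J(V,U) g(Ψ(V,U)))·dV` for measurable `g ≥ 0` vanishing off `S`) ·
`lintegral_comp_avOfRecord_mul_eq_privateChart` ∕ `integral_comp_avOfRecord_mul_eq_privateChart` (socket tested forms BY NAME) ·
★★★ `transportOfRecord_ae_eq_integral_privateChart_of_support` (socket §3 BY NAME, support clause in dag-n09-w6's shape «`ρ U ≠ 0 ⇒ ∀ c, U(β c) ∈ Ω_c(U)`»).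

HONEST FRAMING.  Helper lane of K1⁷; count-neutral; kernel measure theory BY NAME (`Measure.compProd_const` + p616307 + p610288 + def-T's names).  The per-bond inversion data
`(Ω, T, ϑ, j; hΩbl, hright, hlaw)` are HYPOTHESES — NOT constructed here; dag-n09-w6 g3's road reduces them to an injectivity window (PROVED generically in their `EMLFibreMapInjective`,
in flight) + (F) the FORWARD Jacobian law of the one-variable (0.4) fibre map on that window + (S) the support clause — the located remainder shared by N09's `hreg` and N11's (B4)
chart half after this file.  NO chart of Bałaban's ((47), [III] (3.10)–(3.25)) is asserted; the Lie–Haar ∕ (47) edition of the chart half (S1 ∘ S2∘S3, `det S`) is untouched;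
(B4) ∕ (S-α) NOT closed; N11 NOT discharged; K1⁷ ∕ K1⁸ NOT closed, no registered stub touched; counts unmoved (typed 28∕28 · discharged 5∕27 · A 5∕28).  No summit statement is
proved by this seat.  One finite `𝕋⁴_{L^K}` programme at fixed `ε = L^{−K}`; R4 closes only the conditional finite-𝕋⁴ rung `BalabanLadder.UV` — NOT ℝ⁴, NOT OS, NOT a mass gap,
NOT Clay.  No `sorry`, `axiom`, `def`, `instance`, `notation`.
Sources (SHAPE ∕ bookkeeping only): [I] (0.4) p.253, (2.4) p.266, (2.10) p.267; [III] (3.1) p.264, p.267 L18–24.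
-/

noncomputable section

open MeasureTheory ProbabilityTheory Set Function
open scoped ENNReal NNReal

namespace Summit.QuantumFields.YangMills.Theorems.BalabanUVNodesN11TransportOfRecordInPrivateCoordinateChart

open Literature.MathematicalPhysics.QuantumFieldTheory.Balaban1983to89
open Literature.MathematicalPhysics.QuantumFieldTheory.Balaban1983to89.T4AveragingDisintegration
open Literature.MathematicalPhysics.QuantumFieldTheory.Balaban1983to89.T4TriangularPushforward (IsLocal)
open Literature.MathematicalPhysics.QuantumFieldTheory.Balaban1983to89.T4TriangularFibredChart
open Literature.MathematicalPhysics.QuantumFieldTheory.Balaban1983to89.BlockAveragingHaarAC (centralBond centralBond_injective isLocal_avgFun)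
open Literature.MathematicalPhysics.QuantumFieldTheory.Balaban1983to89.ExpMeanLog (expMeanLogSU)
open Summit.QuantumFields.YangMills.Theorems.BalabanUVNodesN11KernelTransportInFibreChart

/-! ## §1  Generic: the private-coordinate chart of a product measure in the SOCKET's orientation (constant fibre reference) -/

section Generic

variable {ι κ G : Type*} [Fintype ι] [Fintype κ] [DecidableEq ι] [MeasurableSpace G]
  {β : κ → ι} {A : (ι → G) → (κ → G)}
  (Ω T : κ → (ι → G) → Set G) (θ : κ → (ι → G) → G → G) (j : κ → (ι → G) → G → ℝ≥0)
  (μ : Measure G) [IsProbabilityMeasure μ] (ν : Measure G) [SigmaFinite ν]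

/-- **THE PRIVATE-COORDINATE CHART IN THE SOCKET'S ORIENTATION** (`T4TriangularFibredChart.pi_restrict_preimage_inter_eq_map_prod_withDensity` read through
`Measure.compProd_const`): with the CONSTANT fibre reference `Kernel.const _ μ^ι`, the coarse reference `(ν^κ)⌊U₀`, the resampled chart `Ψ (V, U) = extend β (c ↦ θ_c(U, V c)) U`
and the Jacobian `J (V, U) = 𝟙[∀ c, V c ∈ T_c(U)]·∏_c j_c(U, V c)`:  `((((ν^κ)⌊U₀) ⊗ₘ Kernel.const _ μ^ι)·J).map Ψ = μ^ι⌊(A⁻¹U₀ ∩ {U | ∀ c, U(β c) ∈ Ω_c(U)})` — dag-n11-d's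
`hpush` with charted set `A⁻¹U₀ ∩ S`. [cite: Balaban1987RG1, (0.4) p.253, (2.4) p.266 and (2.10) p.267 (bookkeeping: the δ-constrained fine integral in chart coordinates)] -/
theorem compProd_const_withDensity_map_triChart_eq_restrict [Nonempty G] (hA : IsLocal β A) (hβ : Injective β) (hAm : Measurable A)
    (hΩm : ∀ c, MeasurableSet {p : (ι → G) × G | p.2 ∈ Ω c p.1}) (hTm : ∀ c, MeasurableSet {p : (ι → G) × G | p.2 ∈ T c p.1})
    (hθm : ∀ c, Measurable fun p : (ι → G) × G => θ c p.1 p.2) (hjm : ∀ c, Measurable fun p : (ι → G) × G => j c p.1 p.2)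
    (hΩbl : ∀ c (U : ι → G) (g : κ → G), Ω c (extend β g U) = Ω c U)
    (hright : ∀ c U, ∀ v ∈ T c U, A (update U (β c) (θ c U v)) c = v)
    (hlaw : ∀ c U, μ.restrict (Ω c U) = ((ν.restrict (T c U)).withDensity fun v => (j c U v : ℝ≥0∞)).map (θ c U))
    {U₀ : Set (κ → G)} (hU₀ : MeasurableSet U₀) :
    ((((Measure.pi fun _ : κ => ν).restrict U₀) ⊗ₘ (Kernel.const (κ → G) (Measure.pi fun _ : ι => μ))).withDensity fun p =>
          (({p : (κ → G) × (ι → G) | ∀ c, p.1 c ∈ T c p.2}.indicator (fun p => ∏ c, j c p.2 (p.1 c)) p : ℝ≥0) : ℝ≥0∞)).map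
        (fun p : (κ → G) × (ι → G) => extend β (fun c => θ c p.2 (p.1 c)) p.2) =
      (Measure.pi fun _ : ι => μ).restrict (A ⁻¹' U₀ ∩ {U | ∀ c, U (β c) ∈ Ω c U}) := by
  rw [Measure.compProd_const]
  exact (pi_restrict_preimage_inter_eq_map_prod_withDensity Ω T θ j μ ν hA hβ hAm hΩm hTm hθm hjm hΩbl hright hlaw hU₀).symm

/-- The same with `U₀ = univ`: coarse reference `ν^κ` ON THE NOSE, charted set the fine domain `S = {U | ∀ c, U(β c) ∈ Ω_c(U)}` — the shape of dag-n11-d's §3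
`transportOfRecord_ae_eq_integral_chart_of_support`. [cite: Balaban1987RG1, (0.4) p.253 and (2.10) p.267 (bookkeeping)] -/
theorem compProd_const_withDensity_map_triChart_eq_restrict_fineDomain [Nonempty G] (hA : IsLocal β A) (hβ : Injective β) (hAm : Measurable A)
    (hΩm : ∀ c, MeasurableSet {p : (ι → G) × G | p.2 ∈ Ω c p.1}) (hTm : ∀ c, MeasurableSet {p : (ι → G) × G | p.2 ∈ T c p.1})
    (hθm : ∀ c, Measurable fun p : (ι → G) × G => θ c p.1 p.2) (hjm : ∀ c, Measurable fun p : (ι → G) × G => j c p.1 p.2)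
    (hΩbl : ∀ c (U : ι → G) (g : κ → G), Ω c (extend β g U) = Ω c U)
    (hright : ∀ c U, ∀ v ∈ T c U, A (update U (β c) (θ c U v)) c = v)
    (hlaw : ∀ c U, μ.restrict (Ω c U) = ((ν.restrict (T c U)).withDensity fun v => (j c U v : ℝ≥0∞)).map (θ c U)) :
    (((Measure.pi fun _ : κ => ν) ⊗ₘ (Kernel.const (κ → G) (Measure.pi fun _ : ι => μ))).withDensity fun p =>
          (({p : (κ → G) × (ι → G) | ∀ c, p.1 c ∈ T c p.2}.indicator (fun p => ∏ c, j c p.2 (p.1 c)) p : ℝ≥0) : ℝ≥0∞)).map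
        (fun p : (κ → G) × (ι → G) => extend β (fun c => θ c p.2 (p.1 c)) p.2) =
      (Measure.pi fun _ : ι => μ).restrict {U | ∀ c, U (β c) ∈ Ω c U} := by
  have h := compProd_const_withDensity_map_triChart_eq_restrict Ω T θ j μ ν hA hβ hAm hΩm hTm hθm hjm hΩbl hright hlaw
    MeasurableSet.univ
  rwa [Measure.restrict_univ, Set.preimage_univ, Set.univ_inter] at h

end Generic

/-! ## §2  At the record: `avg = avOfRecord F N K k` (`= blockAvg expMeanLogSU`), `β = centralBond`, `dU ∕ dV = fieldMeasure = Measure.pi Haar` (`rfl`), `k < K` -/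

section Record

open Node00 hiding SU
open T4Continuum

variable {F : T4Family} {N : ℕ} [NeZero N] {K k : ℕ}
  (Ω T : PBond (F.P K) (k + 1) → GaugeField (F.P K) k (SU N) → Set (SU N))
  (ϑ : PBond (F.P K) (k + 1) → GaugeField (F.P K) k (SU N) → SU N → SU N)
  (jd : PBond (F.P K) (k + 1) → GaugeField (F.P K) k (SU N) → SU N → ℝ≥0)

omit [NeZero N] in
/-- The standing range `k + 1 ≤ m + K` of the `K`-th torus at every step `k < K` (the hypothesis of `isLocal_avgFun` ∕ `centralBond_injective`).
[cite: Balaban1987RG1, (0.1) p.251 (bookkeeping)] -/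
theorem succ_le_m_add_K (hk : k < K) : k + 1 ≤ (F.P K).m + (F.P K).K := by
  show k + 1 ≤ F.m + K
  omega

/-- **★★ `hpush` AT THE RECORD, WINDOWED IN THE COARSE FIELD**: from per-bond inversion data `(Ω, T, ϑ, j; hΩbl, hright, hlaw)` of the (0.4) one-variable fibre maps of
`avOfRecord F N K k` in its private coordinates `β = centralBond`, for every measurable coarse set `U₀`,
`((dV⌊U₀ ⊗ₘ Kernel.const _ dU)·J).map Ψ = dU⌊(Ū⁻¹U₀ ∩ {U | ∀ c, U(β c) ∈ Ω_c(U)})` — dag-n11-d's first socket hypothesis with coarse reference `(fieldMeasure (k+1))⌊U₀`, CONSTANT fibre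
reference `fieldMeasure k`, `Ψ (V,U) = extend β (c ↦ ϑ_c(U, V c)) U`, `J (V,U) = 𝟙[∀ c, V c ∈ T_c(U)]·∏_c j_c(U, V c)`.
[cite: Balaban1987RG1, (0.4) p.253, (2.4) p.266 and (2.10) p.267; Balaban1988Convergent, (3.1) p.264, p.267 L18–24 (bookkeeping)] -/
theorem hpush_privateChart_restrict [DecidableEq (PBond (F.P K) k)] (hk : k < K)
    (hΩm : ∀ c, MeasurableSet {p : GaugeField (F.P K) k (SU N) × SU N | p.2 ∈ Ω c p.1})
    (hTm : ∀ c, MeasurableSet {p : GaugeField (F.P K) k (SU N) × SU N | p.2 ∈ T c p.1})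
    (hθm : ∀ c, Measurable fun p : GaugeField (F.P K) k (SU N) × SU N => ϑ c p.1 p.2)
    (hjm : ∀ c, Measurable fun p : GaugeField (F.P K) k (SU N) × SU N => jd c p.1 p.2)
    (hΩbl : ∀ c (U : GaugeField (F.P K) k (SU N)) (g : PBond (F.P K) (k + 1) → SU N), Ω c (extend centralBond g U) = Ω c U)
    (hright : ∀ c U, ∀ v ∈ T c U, (avOfRecord F N K k).avg (update U (centralBond c) (ϑ c U v)) c = v)
    (hlaw : ∀ c U, (HaarData.haar : Measure (SU N)).restrict (Ω c U) =
      (((HaarData.haar : Measure (SU N)).restrict (T c U)).withDensity fun v => (jd c U v : ℝ≥0∞)).map (ϑ c U))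
    {U₀ : Set (GaugeField (F.P K) (k + 1) (SU N))} (hU₀ : MeasurableSet U₀) :
    ((((fieldMeasure (F.P K) (k + 1) (SU N)).restrict U₀) ⊗ₘ
        (Kernel.const (GaugeField (F.P K) (k + 1) (SU N)) (fieldMeasure (F.P K) k (SU N)))).withDensity fun z =>
          (({p : GaugeField (F.P K) (k + 1) (SU N) × GaugeField (F.P K) k (SU N) | ∀ c, p.1 c ∈ T c p.2}.indicator
            (fun p => ∏ c, jd c p.2 (p.1 c)) z : ℝ≥0) : ℝ≥0∞)).map
        (fun z : GaugeField (F.P K) (k + 1) (SU N) × GaugeField (F.P K) k (SU N) =>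
          (extend centralBond (fun c => ϑ c z.2 (z.1 c)) z.2 : GaugeField (F.P K) k (SU N))) =
      (fieldMeasure (F.P K) k (SU N)).restrict ((avOfRecord F N K k).avg ⁻¹' U₀ ∩ {U | ∀ c, U (centralBond c) ∈ Ω c U}) :=
  compProd_const_withDensity_map_triChart_eq_restrict (ι := PBond (F.P K) k) (κ := PBond (F.P K) (k + 1)) (G := SU N) Ω T ϑ jd
    (HaarData.haar : Measure (SU N)) (HaarData.haar : Measure (SU N)) (isLocal_avgFun (succ_le_m_add_K hk) expMeanLogSU)
    (centralBond_injective (succ_le_m_add_K hk)) (avOfRecord_measurable F N K k) hΩm hTm hθm hjm hΩbl hright hlaw hU₀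

/-- **★★ `hpush` AT THE RECORD** (dag-n11-d's §3 shape, coarse reference `dV = fieldMeasure (k+1)` on the nose, charted set the fine domain):
`((dV ⊗ₘ Kernel.const _ dU)·J).map Ψ = dU⌊{U | ∀ c, U(β c) ∈ Ω_c(U)}`.
[cite: Balaban1987RG1, (0.4) p.253 and (2.10) p.267; Balaban1988Convergent, (3.1) p.264, p.267 L18–24 (bookkeeping)] -/
theorem hpush_privateChart [DecidableEq (PBond (F.P K) k)] (hk : k < K)
    (hΩm : ∀ c, MeasurableSet {p : GaugeField (F.P K) k (SU N) × SU N | p.2 ∈ Ω c p.1})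
    (hTm : ∀ c, MeasurableSet {p : GaugeField (F.P K) k (SU N) × SU N | p.2 ∈ T c p.1})
    (hθm : ∀ c, Measurable fun p : GaugeField (F.P K) k (SU N) × SU N => ϑ c p.1 p.2)
    (hjm : ∀ c, Measurable fun p : GaugeField (F.P K) k (SU N) × SU N => jd c p.1 p.2)
    (hΩbl : ∀ c (U : GaugeField (F.P K) k (SU N)) (g : PBond (F.P K) (k + 1) → SU N), Ω c (extend centralBond g U) = Ω c U)
    (hright : ∀ c U, ∀ v ∈ T c U, (avOfRecord F N K k).avg (update U (centralBond c) (ϑ c U v)) c = v)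
    (hlaw : ∀ c U, (HaarData.haar : Measure (SU N)).restrict (Ω c U) =
      (((HaarData.haar : Measure (SU N)).restrict (T c U)).withDensity fun v => (jd c U v : ℝ≥0∞)).map (ϑ c U)) :
    (((fieldMeasure (F.P K) (k + 1) (SU N)) ⊗ₘ
        (Kernel.const (GaugeField (F.P K) (k + 1) (SU N)) (fieldMeasure (F.P K) k (SU N)))).withDensity fun z =>
          (({p : GaugeField (F.P K) (k + 1) (SU N) × GaugeField (F.P K) k (SU N) | ∀ c, p.1 c ∈ T c p.2}.indicator
            (fun p => ∏ c, jd c p.2 (p.1 c)) z : ℝ≥0) : ℝ≥0∞)).map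
        (fun z : GaugeField (F.P K) (k + 1) (SU N) × GaugeField (F.P K) k (SU N) =>
          (extend centralBond (fun c => ϑ c z.2 (z.1 c)) z.2 : GaugeField (F.P K) k (SU N))) =
      (fieldMeasure (F.P K) k (SU N)).restrict {U | ∀ c, U (centralBond c) ∈ Ω c U} :=
  compProd_const_withDensity_map_triChart_eq_restrict_fineDomain (ι := PBond (F.P K) k) (κ := PBond (F.P K) (k + 1)) (G := SU N) Ω T ϑ jd
    (HaarData.haar : Measure (SU N)) (HaarData.haar : Measure (SU N)) (isLocal_avgFun (succ_le_m_add_K hk) expMeanLogSU)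
    (centralBond_injective (succ_le_m_add_K hk)) (avOfRecord_measurable F N K k) hΩm hTm hθm hjm hΩbl hright hlaw

/-- **★ `hfib` AT THE RECORD**: for ANY coarse measure `m` (in particular `dV` or `dV⌊U₀`), the resampled chart lies over the coarse variable `((m ⊗ₘ Kernel.const _ dU)·J)`-a.e.:
`Ū(Ψ(V,U)) = V` — dag-n11-d's second socket hypothesis (p616307 `ae_apply_triChart_eq`: the identity holds wherever `J ≠ 0`).
[cite: Balaban1987RG1, (2.4) p.266 and (2.10) p.267 (bookkeeping: the chart parametrises the fibre)] -/
theorem hfib_privateChart [DecidableEq (PBond (F.P K) k)] (hk : k < K)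
    (hTm : ∀ c, MeasurableSet {p : GaugeField (F.P K) k (SU N) × SU N | p.2 ∈ T c p.1})
    (hjm : ∀ c, Measurable fun p : GaugeField (F.P K) k (SU N) × SU N => jd c p.1 p.2)
    (hright : ∀ c U, ∀ v ∈ T c U, (avOfRecord F N K k).avg (update U (centralBond c) (ϑ c U v)) c = v)
    (m : Measure (GaugeField (F.P K) (k + 1) (SU N))) :
    ∀ᵐ z ∂((m ⊗ₘ (Kernel.const (GaugeField (F.P K) (k + 1) (SU N)) (fieldMeasure (F.P K) k (SU N)))).withDensity fun z =>
          (({p : GaugeField (F.P K) (k + 1) (SU N) × GaugeField (F.P K) k (SU N) | ∀ c, p.1 c ∈ T c p.2}.indicator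
            (fun p => ∏ c, jd c p.2 (p.1 c)) z : ℝ≥0) : ℝ≥0∞)),
      (avOfRecord F N K k).avg (extend centralBond (fun c => ϑ c z.2 (z.1 c)) z.2 : GaugeField (F.P K) k (SU N)) = z.1 :=
  ae_apply_triChart_eq (ι := PBond (F.P K) k) (κ := PBond (F.P K) (k + 1)) (G := SU N) T ϑ jd
    (isLocal_avgFun (succ_le_m_add_K hk) expMeanLogSU) (centralBond_injective (succ_le_m_add_K hk)) hright hTm hjm _

omit [NeZero N] in
/-- The resampled chart at the record is measurable (p616307 `measurable_triChart`). [cite: Balaban1987RG1, (2.10) p.267 (bookkeeping)] -/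
theorem measurable_privateChart (hk : k < K) (hθm : ∀ c, Measurable fun p : GaugeField (F.P K) k (SU N) × SU N => ϑ c p.1 p.2) :
    Measurable fun z : GaugeField (F.P K) (k + 1) (SU N) × GaugeField (F.P K) k (SU N) =>
      (extend centralBond (fun c => ϑ c z.2 (z.1 c)) z.2 : GaugeField (F.P K) k (SU N)) :=
  measurable_triChart (ι := PBond (F.P K) k) (κ := PBond (F.P K) (k + 1)) (G := SU N) ϑ (centralBond_injective (succ_le_m_add_K hk)) hθm

omit [NeZero N] in
/-- Its Jacobian is measurable (p616307 `measurable_triJacobian`). [cite: Balaban1987RG1, (2.10) p.267 (bookkeeping)] -/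
theorem measurable_privateJacobian (hTm : ∀ c, MeasurableSet {p : GaugeField (F.P K) k (SU N) × SU N | p.2 ∈ T c p.1})
    (hjm : ∀ c, Measurable fun p : GaugeField (F.P K) k (SU N) × SU N => jd c p.1 p.2) :
    Measurable fun z : GaugeField (F.P K) (k + 1) (SU N) × GaugeField (F.P K) k (SU N) =>
      {p : GaugeField (F.P K) (k + 1) (SU N) × GaugeField (F.P K) k (SU N) | ∀ c, p.1 c ∈ T c p.2}.indicator
        (fun p => ∏ c, jd c p.2 (p.1 c)) z :=
  measurable_triJacobian (ι := PBond (F.P K) k) (κ := PBond (F.P K) (k + 1)) (G := SU N) T jd hTm hjm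

/-- **★★ THE MEASURE IDENTITY AT THE RECORD — «`∫dU δ(ŪV⁻¹) g(U)` COMPUTED BY RESAMPLING THE CENTRAL BONDS», kernel-free, no integrability** (dag-n11-d §1 ★★
`map_withDensity_eq_withDensity_lintegral_chart` BY NAME on `hpush_privateChart` ∕ `hfib_privateChart`): for every measurable `g ≥ 0` vanishing off the charted windows,
`(g·dU).map Ū = (V ↦ ∫⁻ dU 𝟙[∀ c, V c ∈ T_c(U)]·∏_c j_c(U, V c) · g(extend β (ϑ_c(U, V c))_c U)) · dV`.
[cite: Balaban1987RG1, (0.4) p.253; Balaban1988Convergent, (3.1) p.264, p.267 L18–24] -/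
theorem map_withDensity_avOfRecord_eq_withDensity_lintegral_privateChart [DecidableEq (PBond (F.P K) k)] (hk : k < K)
    (hΩm : ∀ c, MeasurableSet {p : GaugeField (F.P K) k (SU N) × SU N | p.2 ∈ Ω c p.1})
    (hTm : ∀ c, MeasurableSet {p : GaugeField (F.P K) k (SU N) × SU N | p.2 ∈ T c p.1})
    (hθm : ∀ c, Measurable fun p : GaugeField (F.P K) k (SU N) × SU N => ϑ c p.1 p.2)
    (hjm : ∀ c, Measurable fun p : GaugeField (F.P K) k (SU N) × SU N => jd c p.1 p.2)
    (hΩbl : ∀ c (U : GaugeField (F.P K) k (SU N)) (g : PBond (F.P K) (k + 1) → SU N), Ω c (extend centralBond g U) = Ω c U)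
    (hright : ∀ c U, ∀ v ∈ T c U, (avOfRecord F N K k).avg (update U (centralBond c) (ϑ c U v)) c = v)
    (hlaw : ∀ c U, (HaarData.haar : Measure (SU N)).restrict (Ω c U) =
      (((HaarData.haar : Measure (SU N)).restrict (T c U)).withDensity fun v => (jd c U v : ℝ≥0∞)).map (ϑ c U))
    {g : GaugeField (F.P K) k (SU N) → ℝ≥0∞} (hg : Measurable g) (hgS : ∀ U, g U ≠ 0 → ∀ c, U (centralBond c) ∈ Ω c U) :
    ((fieldMeasure (F.P K) k (SU N)).withDensity g).map (avOfRecord F N K k).avg =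
      (fieldMeasure (F.P K) (k + 1) (SU N)).withDensity fun V => ∫⁻ U,
        (({p : GaugeField (F.P K) (k + 1) (SU N) × GaugeField (F.P K) k (SU N) | ∀ c, p.1 c ∈ T c p.2}.indicator
            (fun p => ∏ c, jd c p.2 (p.1 c)) (V, U) : ℝ≥0) : ℝ≥0∞) *
          g (extend centralBond (fun c => ϑ c U (V c)) U : GaugeField (F.P K) k (SU N)) ∂(fieldMeasure (F.P K) k (SU N)) :=
  map_withDensity_eq_withDensity_lintegral_chart (κ := Kernel.const (GaugeField (F.P K) (k + 1) (SU N)) (fieldMeasure (F.P K) k (SU N)))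
    (avOfRecord_measurable F N K k) (measurable_privateChart ϑ hk hθm) (measurable_privateJacobian T jd hTm hjm)
    (hpush_privateChart Ω T ϑ jd hk hΩm hTm hθm hjm hΩbl hright hlaw) (hfib_privateChart T ϑ jd hk hTm hjm hright _) hg
    (fun U hU => by
      by_contra h
      exact hU (hgS U h))

/-- **THE TESTED `ℝ≥0∞` FORM AT THE RECORD** (dag-n11-d §1 ★ `lintegral_comp_avg_mul_eq_chart` BY NAME): `∫dU φ(Ū) g(U) = ∫dV φ(V) ∫dU J(V,U) g(Ψ(V,U))` for measurable
`φ, g ≥ 0` with `g` vanishing off the charted windows. [cite: Balaban1987RG1, (0.4) p.253; Balaban1988Convergent, (2.21) p.258, p.267] -/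
theorem lintegral_comp_avOfRecord_mul_eq_privateChart [DecidableEq (PBond (F.P K) k)] (hk : k < K)
    (hΩm : ∀ c, MeasurableSet {p : GaugeField (F.P K) k (SU N) × SU N | p.2 ∈ Ω c p.1})
    (hTm : ∀ c, MeasurableSet {p : GaugeField (F.P K) k (SU N) × SU N | p.2 ∈ T c p.1})
    (hθm : ∀ c, Measurable fun p : GaugeField (F.P K) k (SU N) × SU N => ϑ c p.1 p.2)
    (hjm : ∀ c, Measurable fun p : GaugeField (F.P K) k (SU N) × SU N => jd c p.1 p.2)
    (hΩbl : ∀ c (U : GaugeField (F.P K) k (SU N)) (g : PBond (F.P K) (k + 1) → SU N), Ω c (extend centralBond g U) = Ω c U)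
    (hright : ∀ c U, ∀ v ∈ T c U, (avOfRecord F N K k).avg (update U (centralBond c) (ϑ c U v)) c = v)
    (hlaw : ∀ c U, (HaarData.haar : Measure (SU N)).restrict (Ω c U) =
      (((HaarData.haar : Measure (SU N)).restrict (T c U)).withDensity fun v => (jd c U v : ℝ≥0∞)).map (ϑ c U))
    {φ : GaugeField (F.P K) (k + 1) (SU N) → ℝ≥0∞} (hφ : Measurable φ)
    {g : GaugeField (F.P K) k (SU N) → ℝ≥0∞} (hg : Measurable g) (hgS : ∀ U, g U ≠ 0 → ∀ c, U (centralBond c) ∈ Ω c U) :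
    ∫⁻ U, φ ((avOfRecord F N K k).avg U) * g U ∂(fieldMeasure (F.P K) k (SU N)) =
      ∫⁻ V, φ V * ∫⁻ U,
        (({p : GaugeField (F.P K) (k + 1) (SU N) × GaugeField (F.P K) k (SU N) | ∀ c, p.1 c ∈ T c p.2}.indicator
            (fun p => ∏ c, jd c p.2 (p.1 c)) (V, U) : ℝ≥0) : ℝ≥0∞) *
          g (extend centralBond (fun c => ϑ c U (V c)) U : GaugeField (F.P K) k (SU N)) ∂(fieldMeasure (F.P K) k (SU N))
        ∂(fieldMeasure (F.P K) (k + 1) (SU N)) :=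
  lintegral_comp_avg_mul_eq_chart (κ := Kernel.const (GaugeField (F.P K) (k + 1) (SU N)) (fieldMeasure (F.P K) k (SU N)))
    (avOfRecord_measurable F N K k) (measurable_privateChart ϑ hk hθm) (measurable_privateJacobian T jd hTm hjm)
    (hpush_privateChart Ω T ϑ jd hk hΩm hTm hθm hjm hΩbl hright hlaw) (hfib_privateChart T ϑ jd hk hTm hjm hright _) hφ hg
    (fun U hU => by
      by_contra h
      exact hU (hgS U h))

/-- **THE TESTED BOCHNER FORM AT THE RECORD** (dag-n11-d §2 ★ `integral_comp_avg_mul_eq_chart` BY NAME): `∫dU φ(Ū) ρ(U) = ∫dV φ(V) ∫dU J(V,U) ρ(Ψ(V,U))` for an integrable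
measurable real `ρ` vanishing off the charted windows and a bounded measurable `φ`. [cite: Balaban1987RG1, (0.4) p.253; Balaban1988Convergent, (2.21) p.258, p.267] -/
theorem integral_comp_avOfRecord_mul_eq_privateChart [DecidableEq (PBond (F.P K) k)] (hk : k < K)
    (hΩm : ∀ c, MeasurableSet {p : GaugeField (F.P K) k (SU N) × SU N | p.2 ∈ Ω c p.1})
    (hTm : ∀ c, MeasurableSet {p : GaugeField (F.P K) k (SU N) × SU N | p.2 ∈ T c p.1})
    (hθm : ∀ c, Measurable fun p : GaugeField (F.P K) k (SU N) × SU N => ϑ c p.1 p.2)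
    (hjm : ∀ c, Measurable fun p : GaugeField (F.P K) k (SU N) × SU N => jd c p.1 p.2)
    (hΩbl : ∀ c (U : GaugeField (F.P K) k (SU N)) (g : PBond (F.P K) (k + 1) → SU N), Ω c (extend centralBond g U) = Ω c U)
    (hright : ∀ c U, ∀ v ∈ T c U, (avOfRecord F N K k).avg (update U (centralBond c) (ϑ c U v)) c = v)
    (hlaw : ∀ c U, (HaarData.haar : Measure (SU N)).restrict (Ω c U) =
      (((HaarData.haar : Measure (SU N)).restrict (T c U)).withDensity fun v => (jd c U v : ℝ≥0∞)).map (ϑ c U))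
    {ρ : Density (F.P K) k (SU N)} (hρm : Measurable ρ) (hρ : Integrable ρ (fieldMeasure (F.P K) k (SU N)))
    (hS : ∀ U, ρ U ≠ 0 → ∀ c, U (centralBond c) ∈ Ω c U)
    {φ : GaugeField (F.P K) (k + 1) (SU N) → ℝ} (hφ : Measurable φ) {C : ℝ} (hC : ∀ V, |φ V| ≤ C) :
    ∫ U, φ ((avOfRecord F N K k).avg U) * ρ U ∂(fieldMeasure (F.P K) k (SU N)) =
      ∫ V, φ V * ∫ U,
        (({p : GaugeField (F.P K) (k + 1) (SU N) × GaugeField (F.P K) k (SU N) | ∀ c, p.1 c ∈ T c p.2}.indicator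
            (fun p => ∏ c, jd c p.2 (p.1 c)) (V, U) : ℝ≥0) : ℝ) *
          ρ (extend centralBond (fun c => ϑ c U (V c)) U : GaugeField (F.P K) k (SU N)) ∂(fieldMeasure (F.P K) k (SU N))
        ∂(fieldMeasure (F.P K) (k + 1) (SU N)) :=
  integral_comp_avg_mul_eq_chart (κ := Kernel.const (GaugeField (F.P K) (k + 1) (SU N)) (fieldMeasure (F.P K) k (SU N)))
    (avOfRecord_measurable F N K k) (measurable_privateChart ϑ hk hθm) (measurable_privateJacobian T jd hTm hjm)
    (hpush_privateChart Ω T ϑ jd hk hΩm hTm hθm hjm hΩbl hright hlaw) (hfib_privateChart T ϑ jd hk hTm hjm hright _) hρm hρ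
    (fun U hU => by
      by_contra h
      exact hU (hS U h))
    hφ hC

/-- **★★★ def-T's ONE-STEP TRANSPORT OF RECORD IN THE PRIVATE-COORDINATE CHART** (dag-n11-d §3 ★★ `transportOfRecord_ae_eq_integral_chart_of_support` BY NAME on
`hpush_privateChart` ∕ `hfib_privateChart`): for `k < K`, per-bond inversion data `(Ω, T, ϑ, j)` of the (0.4) one-variable fibre maps of `avOfRecord F N K k` in the central
crossing bonds, and a `dU`-integrable measurable density `ρ` with the SUPPORT CLAUSE «`ρ U ≠ 0 ⇒` every private coordinate `U(β c)` lies in its window `Ω_c(U)`»,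
`transportOfRecord F N K k ρ =ᵐ[dV] V ↦ ∫ dU 𝟙[∀ c, V c ∈ T_c(U)]·∏_c j_c(U, V c) · ρ(extend β (ϑ_c(U, V c))_c U)` — print's `(Tρ)(V) = ∫dU δ(ŪV⁻¹)ρ(U)` ([I] (0.4), [III] (3.1))
with the δ-functions removed by solving `Ū′(c) = V(c)` for the central bond variable of each coarse bond (def-T's version caveat: `dV`-a.e.).  The inversions are
displayed, not constructed. [cite: Balaban1988Convergent, (3.1) p.264, p.267 L18–24; Balaban1987RG1, (0.4) p.253, (2.4) p.266 and (2.10) p.267] -/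
theorem transportOfRecord_ae_eq_integral_privateChart_of_support [DecidableEq (PBond (F.P K) k)] (hk : k < K)
    (hΩm : ∀ c, MeasurableSet {p : GaugeField (F.P K) k (SU N) × SU N | p.2 ∈ Ω c p.1})
    (hTm : ∀ c, MeasurableSet {p : GaugeField (F.P K) k (SU N) × SU N | p.2 ∈ T c p.1})
    (hθm : ∀ c, Measurable fun p : GaugeField (F.P K) k (SU N) × SU N => ϑ c p.1 p.2)
    (hjm : ∀ c, Measurable fun p : GaugeField (F.P K) k (SU N) × SU N => jd c p.1 p.2)
    (hΩbl : ∀ c (U : GaugeField (F.P K) k (SU N)) (g : PBond (F.P K) (k + 1) → SU N), Ω c (extend centralBond g U) = Ω c U)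
    (hright : ∀ c U, ∀ v ∈ T c U, (avOfRecord F N K k).avg (update U (centralBond c) (ϑ c U v)) c = v)
    (hlaw : ∀ c U, (HaarData.haar : Measure (SU N)).restrict (Ω c U) =
      (((HaarData.haar : Measure (SU N)).restrict (T c U)).withDensity fun v => (jd c U v : ℝ≥0∞)).map (ϑ c U))
    {ρ : Density (F.P K) k (SU N)} (hρm : Measurable ρ) (hρ : Integrable ρ (fieldMeasure (F.P K) k (SU N)))
    (hS : ∀ U, ρ U ≠ 0 → ∀ c, U (centralBond c) ∈ Ω c U) :
    transportOfRecord F N K k ρ =ᵐ[fieldMeasure (F.P K) (k + 1) (SU N)] fun V => ∫ U,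
        (({p : GaugeField (F.P K) (k + 1) (SU N) × GaugeField (F.P K) k (SU N) | ∀ c, p.1 c ∈ T c p.2}.indicator
            (fun p => ∏ c, jd c p.2 (p.1 c)) (V, U) : ℝ≥0) : ℝ) *
          ρ (extend centralBond (fun c => ϑ c U (V c)) U : GaugeField (F.P K) k (SU N)) ∂(fieldMeasure (F.P K) k (SU N)) :=
  transportOfRecord_ae_eq_integral_chart_of_support (κ := Kernel.const (GaugeField (F.P K) (k + 1) (SU N)) (fieldMeasure (F.P K) k (SU N)))
    hk (measurable_privateChart ϑ hk hθm) (measurable_privateJacobian T jd hTm hjm)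
    (hpush_privateChart Ω T ϑ jd hk hΩm hTm hθm hjm hΩbl hright hlaw) (hfib_privateChart T ϑ jd hk hTm hjm hright _) hρm hρ
    (fun U hU => by
      by_contra h
      exact hU (hS U h))

end Record

end Summit.QuantumFields.YangMills.Theorems.BalabanUVNodesN11TransportOfRecordInPrivateCoordinateChart

end
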